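import Summits.Ventures.YMGap.RobustBall.UniformMassGapZdG
import Summits.Ventures.YMGap.RobustBall.RobustStarDoorZdVariance
import Literature.Probability.LatticeModels.DobrushinShlosmanSuperSolutionStates
import HarnessLib

/-!
# Venture YMGap, track ROBUST-BALL (Y2) — the vertex-star door on `ℤ^d` at the GEOMETRIC rate: every star cell of
# the tree clusters at rate `log(1/max(ρ₀,½))/(D+2)` instead of `starRate d ρ₀/(D+2)`

HONEST FRAMING. WHAT THIS IS: a venture file (cell `pub-ymgap`, track Y2 ROBUST-BALL, seat rb-p1, theorems only). ds-2's
star door on `ℤ^d` (`StarDoorZd.lean`, `RobustStarDoorZd.lean`) certifies a PER-STAR received sum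
`Σ_y K(s; y → x) ≤ ρ` (`StarWindowBoundZdR`, last clause) but feeds it to the tree's Dobrushin–Shlosman comparison written
for the AVERAGED condition `C_V`, whose honest three-zone analysis yields the rate
`starRate d ρ = (1−ρ)²/(2(4dρ+1))`. Under the per-window condition Föllmer's super-solution argument applies
(Literature `DobrushinShlosmanSuperSolution*.lean`, this seat: `|E₁ F − E₂ F| ≤ R Σ γ₀^{ℓ} δ`), and this file re-runs
the door through it:
* `abs_covariance_le_of_starWindowBoundZdR_geometric` — EVERY Gibbs measure: `|cov_μ(f,g)| ≤ 8N ρ^{⌊d(Δf,Δg)/(D+2)⌋} (Σδf)(Σδg)`;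
* `perturbedClustering_of_starWindowBoundZdR_geometric` — `PerturbedClustering d N β W supp (log(1/max(ρ,½))/(D+2)) (16N)`
  (compare `perturbedClustering_of_starWindowBoundZdR`: rate `starRate d ρ/(D+2)`, constant `16N e^{starRate}`);
* `uniformMassGapOnBallZdG_of_robustStar_geometric` / `_variance_geometric` — the uniform currency on the gauge-invariant
  tier-1 ball through ds-2's robust star door (modulus and variance forms) with rate `log(1/max(ρ₀,½))/(max R 1 + 4)`;
* `SU(2)`, `d = 4` schema and LEGIBLE cells on the certificates already in the tree:
  `(β_W; ε₀, ε₁) = (1/8; 37/500, 37/1000)`: rate `log 2/(max R 1 + 4)` (was `(1/32)/…`); `(1/8; 37/250, 37/500)`: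
  `log(25/13)/…` (was `1/81`); `(1/4; 11/200, 11/400)`, PAST THE SINGLE-LINK THRESHOLD: `log(4/3)/…` (was `1/416`), constant
  `32 n²` throughout (the explicit frontier rates and the segment `0 ≤ β_W ≤ 1/3` are in `StarDoorZdGeometricCells.lean`).
WHAT THIS IS NOT: the rates remain one-sided comparison rates (lower bounds on the inverse correlation length in units
of the door's locality radius), tiny at the frontier because the certified received sum is within `3·10⁻³` of `1`
there; lattice strong coupling only, nothing about the continuum limit or a Clay-sense mass gap.
-/

noncomputable section

open MeasureTheory ProbabilityTheory Function Finset Real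
open scoped NNReal
open Literature.Probability.LatticeModels
open Literature.Probability.LatticeModels.DobrushinMetric (IsLipBound)
open Literature.MathematicalPhysics.QuantumLattice
open Literature.MathematicalPhysics.QuantumFieldTheory hiding ZdEdge Site
open Literature.MathematicalPhysics.QuantumFieldTheory.Balaban1983to89.StrongCouplingDobrushinWindow
  (OneLinkKRModulus)
open Summit.QuantumFields.BalabanUV.InfraRed.StrongCouplingPoincareDoorSUN (OneLinkPoincareSUN)
open Summit.QuantumFields.BalabanUV.InfraRed.StrongCouplingVarianceDoorSUN (OneLinkVarianceBound)
open Summit.Ventures.YMGap.DSWindowZd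
open Summit.Ventures.YMGap.StarResolventDim (Delta gaugeR doorPoly gaugeR_lt_one_of_door)

namespace Summit.Ventures.YMGap.RobustBall

variable {d N : ℕ}

/-! ### The door at the geometric rate -/

/-- **EXPONENTIAL CLUSTERING OF EVERY GIBBS MEASURE through the radius-`D` star door, GEOMETRIC RATE.** Under the
hypotheses of `abs_covariance_le_of_starWindowBoundZdR` (specification with quasilocal star kernels of radius `D ≥ 1`,
star window bound with received sum `0 ≤ ρ < 1`, Frobenius weight), every Gibbs measure `μ` satisfies
`|cov_μ(f, g)| ≤ 2(2√N)² · ρ^{⌊dist(Δf,Δg)/(D+2)⌋} · (Σ δf)(Σ δg)` (Literature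
`DobrushinShlosman.abs_covariance_le_of_window_geometric`; the two-set profile `exists_starProfileR`). -/
theorem abs_covariance_le_of_starWindowBoundZdR_geometric {γ : Specification (ZdEdge d) (SUN N)}
    (hγ : IsSpecification γ) {D : ℕ} (hD : 1 ≤ D)
    (hloc : ∀ (c : ZdEdge d) (ζ ζ' : LGConfig d (SUN N)), (∀ v ∈ starNbhdZdR D c.1, ζ v = ζ' v) →
      ∀ (f : LGConfig d (SUN N) → ℝ), Measurable f → (∃ B, ∀ σ, |f σ| ≤ B) →
        DependsOn f (starWinZd c : Set (ZdEdge d)) →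
        ∫ σ, f σ ∂(γ (starWinZd c) ζ) = ∫ σ, f σ ∂(γ (starWinZd c) ζ'))
    {ρ : ℝ} (hρ0 : 0 ≤ ρ) (hρ1 : ρ < 1) (h : StarWindowBoundZdR d N γ D ρ suFrobDist)
    {μ : Measure (LGConfig d (SUN N))} (hμ : IsGibbsMeasure γ μ)
    {f g : LGConfig d (SUN N) → ℝ} (hfm : Measurable f) (hgm : Measurable g) {Bf Bg : ℝ}
    (hBf : ∀ σ, |f σ| ≤ Bf) (hBg : ∀ σ, |g σ| ≤ Bg) {Δf Δg : Finset (ZdEdge d)}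
    (hfdep : DependsOn f (Δf : Set (ZdEdge d))) (hgdep : DependsOn g (Δg : Set (ZdEdge d)))
    {δf δg : ZdEdge d → ℝ} (hδf : IsLipBound suFrobDist f δf) (hδg : IsLipBound suFrobDist g δg) :
    |cov[f, g; μ]| ≤ 2 * (2 * Real.sqrt N) ^ 2 * ρ ^ ⌊setDistEdges Δf Δg / (D + 2 : ℕ)⌋₊ *
      (∑ x ∈ Δf, δf x) * ∑ y ∈ Δg, δg y := by
  classical
  obtain ⟨K, hK0, hKsupp, hcontract, hsum⟩ := h
  have hR₀ : (0 : ℝ) ≤ 2 * Real.sqrt N := by positivity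
  obtain ⟨Λ, ℓ, hΔΛ, hU, hℓ, hL⟩ := exists_starProfileR hD K hKsupp Δf Δg
  exact DobrushinShlosman.abs_covariance_le_of_window_geometric hγ suFrobDist_nonneg suFrobDist_le hR₀
    (win := starWinZd) (nbhd := fun c => starNbhdZdR D c.1) (K := fun c => K c.1) (fun c y x => hK0 _ _ _)
    self_mem_starWinZd (fun c => vertexStarZd_subset_starNbhdZdR hD c.1) (fun c y x => hKsupp _ _ _)
    hcontract hloc hρ0 hρ1 (fun c x hx => hsum c.1 x hx) hμ hfm hgm hBf hBg hfdep hgdep hδf hδg Λ hΔΛ ℓ _ hU hℓ hL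

/-- **Explicit clustering data from a star window bound, GEOMETRIC RATE**: for a member with continuous own-link terms
supported by `supp` with range `R`, a star window bound for `perturbedYM (fundamentalRep (Fin N)) (N β) W supp` with locality
radius `D ≥ R + 2` and received sum `ρ < 1` gives
`PerturbedClustering d N β W supp (log(1/max(ρ,½))/(D+2)) (16N)` (`ρ' = max(ρ,½)`: `ρ'^{⌊x⌋} ≤ ρ'^{−1} e^{−log(1/ρ') x} ≤ 2 e^{−log(1/ρ') x}`). -/
theorem perturbedClustering_of_starWindowBoundZdR_geometric {β ρ : ℝ} {R D : ℕ}
    {W : Potential (ZdEdge d) (SUN N)} (hWc : ∀ X, Continuous (W X))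
    (hWdep : ∀ X, DependsOn (W X) (↑X : Set (ZdEdge d)))
    {supp : Finset (ZdEdge d) → Finset (Finset (ZdEdge d))} (hsupp : W.IsSupportedBy supp)
    (hR : ∀ e, ∀ X ∈ supp {e}, e ∈ X → ∀ y ∈ X, ‖e.1 - y.1‖ ≤ (R : ℝ)) (hD : R + 2 ≤ D)
    (hρ1 : ρ < 1)
    (h : StarWindowBoundZdR d N (perturbedYM (d := d) (fundamentalRep (Fin N)) (N * β) W supp) D ρ
      suFrobDist) :
    PerturbedClustering d N β W supp (-Real.log (max ρ (1 / 2)) / (D + 2 : ℕ)) (16 * N) := by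
  -- adapted from `perturbedClustering_of_starWindowBoundZdR`
  classical
  haveI : SecondCountableTopology (Matrix (Fin N) (Fin N) ℂ) :=
    inferInstanceAs (SecondCountableTopology (Fin N → Fin N → ℂ))
  haveI : SecondCountableTopology (SUN N) := Topology.IsEmbedding.subtypeVal.secondCountableTopology
  have hW : W.IsAdapted := fun X => ⟨hWdep X, (hWc X).measurable⟩
  have hWb : ∀ X, ∃ C, ∀ U, |W X U| ≤ C := fun X => exists_bound_of_continuous (hWc X)
  have hγ : IsSpecification (perturbedYM (d := d) (fundamentalRep (Fin N)) (N * β) W supp) :=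
    isSpecification_perturbedYM _ (continuous_fundamentalRep (Fin N)) _ hW hWb hsupp
  have hD1 : 1 ≤ D := by omega
  have hloc : ∀ (c : ZdEdge d) (ζ ζ' : LGConfig d (SUN N)), (∀ v ∈ starNbhdZdR D c.1, ζ v = ζ' v) →
      ∀ (f : LGConfig d (SUN N) → ℝ), Measurable f → (∃ B, ∀ σ, |f σ| ≤ B) →
        DependsOn f (starWinZd c : Set (ZdEdge d)) →
        ∫ σ, f σ ∂(perturbedYM (d := d) (fundamentalRep (Fin N)) (N * β) W supp (starWinZd c) ζ) =
          ∫ σ, f σ ∂(perturbedYM (d := d) (fundamentalRep (Fin N)) (N * β) W supp (starWinZd c) ζ') :=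
    fun c ζ ζ' hζ f hfm _ hfdep => perturbed_star_hloc _ (continuous_fundamentalRep (Fin N)) _
      (fun X => (hWc X).measurable) hWdep hsupp hR hD c ζ ζ' hζ f hfm hfdep
  -- the received sum `ρ' = max(ρ, 1/2)`
  set ρ' : ℝ := max ρ (1 / 2) with hρ'
  have hρ'h : 1 / 2 ≤ ρ' := le_max_right _ _
  have hρ'0 : 0 < ρ' := lt_of_lt_of_le (by norm_num) hρ'h
  have hρ'1 : ρ' < 1 := max_lt hρ1 (by norm_num)
  have h' : StarWindowBoundZdR d N (perturbedYM (d := d) (fundamentalRep (Fin N)) (N * β) W supp) D ρ' suFrobDist :=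
    h.mono_rho (le_max_left _ _)
  intro μ hμ n F₁ F₂ Λ₁ Λ₂ K₁ K₂ h₁ h₂ _ hF₁ hF₂
  set κ : ℝ := -Real.log ρ' with hκ
  have hκ0 : 0 ≤ κ := by rw [hκ, neg_nonneg]; exact Real.log_nonpos hρ'0.le hρ'1.le
  have hD2 : (0 : ℝ) < ((D + 2 : ℕ) : ℝ) := by positivity
  have hμ' : IsGibbsMeasure (perturbedYM (d := d) (fundamentalRep (Fin N)) (N * β) W supp) μ := hμ
  haveI := hμ'.isProbabilityMeasure
  have hA : ∀ a b : SUN N, dist (suEntries a) (suEntries b) ≤ 1 * suFrobDist a b := fun a b => by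
    rw [one_mul]; exact dist_suEntries_le_suFrobDist a b
  have key := abs_covariance_le_of_starWindowBoundZdR_geometric hγ hD1 hloc hρ'0.le hρ'1 h' hμ'
    hF₁.measurable hF₂.measurable hF₁.abs_le hF₂.abs_le hF₁.dependsOn hF₂.dependsOn
    (hF₁.isLipBound zero_le_one hA) (hF₂.isLipBound zero_le_one hA)
  have hK₁ : (0 : ℝ) ≤ K₁ := K₁.2
  have hK₂ : (0 : ℝ) ≤ K₂ := K₂.2
  have hn₁ : (Λ₁.card : ℝ) ≤ n := by exact_mod_cast h₁
  have hn₂ : (Λ₂.card : ℝ) ≤ n := by exact_mod_cast h₂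
  have hsum₁ : ∑ y ∈ Λ₁, (if y ∈ Λ₁ then 1 * (K₁ : ℝ) else 0) ≤ n * K₁ := by
    rw [Finset.sum_ite_of_true (fun y hy => hy), Finset.sum_const, nsmul_eq_mul, one_mul]
    exact mul_le_mul_of_nonneg_right hn₁ hK₁
  have hsum₂ : ∑ y ∈ Λ₂, (if y ∈ Λ₂ then 1 * (K₂ : ℝ) else 0) ≤ n * K₂ := by
    rw [Finset.sum_ite_of_true (fun y hy => hy), Finset.sum_const, nsmul_eq_mul, one_mul]
    exact mul_le_mul_of_nonneg_right hn₂ hK₂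
  have hsum₁0 : 0 ≤ ∑ y ∈ Λ₁, (if y ∈ Λ₁ then 1 * (K₁ : ℝ) else 0) :=
    Finset.sum_nonneg fun y hy => by rw [if_pos hy]; positivity
  -- `ρ'^{⌊x⌋} = e^{−κ ⌊x⌋} ≤ e^{κ} e^{−(κ/(D+2)) dist} ≤ 2 e^{−(κ/(D+2)) dist}`
  have hpow : ρ' ^ ⌊setDistEdges Λ₁ Λ₂ / (D + 2 : ℕ)⌋₊ =
      Real.exp (-(κ * ⌊setDistEdges Λ₁ Λ₂ / (D + 2 : ℕ)⌋₊)) := by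
    rw [hκ, neg_mul, neg_neg, mul_comm, Real.exp_nat_mul, Real.exp_log hρ'0]
  have hgeom : Real.exp (-(κ * ⌊setDistEdges Λ₁ Λ₂ / (D + 2 : ℕ)⌋₊)) ≤
      Real.exp κ * Real.exp (-(κ / (D + 2 : ℕ)) * setDistEdges Λ₁ Λ₂) := by
    rw [← Real.exp_add]
    refine Real.exp_le_exp.2 ?_
    have hfl : setDistEdges Λ₁ Λ₂ / (D + 2 : ℕ) - 1 ≤ (⌊setDistEdges Λ₁ Λ₂ / (D + 2 : ℕ)⌋₊ : ℝ) := by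
      have := Nat.lt_floor_add_one (setDistEdges Λ₁ Λ₂ / (D + 2 : ℕ))
      linarith
    have := mul_le_mul_of_nonneg_left hfl hκ0
    have e1 : -(κ / (D + 2 : ℕ)) * setDistEdges Λ₁ Λ₂ = -(κ * (setDistEdges Λ₁ Λ₂ / (D + 2 : ℕ))) := by
      field_simp
    rw [e1]
    linarith
  have hexpκ : Real.exp κ ≤ 2 := by
    rw [hκ, Real.exp_neg, Real.exp_log hρ'0]
    rw [inv_le_comm₀ hρ'0 (by norm_num : (0:ℝ) < 2)]
    linarith
  have h16 : (2 * (2 * Real.sqrt N) ^ 2 : ℝ) = 8 * N := by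
    rw [mul_pow, Real.sq_sqrt (Nat.cast_nonneg _)]; ring
  calc |cov[F₁, F₂; μ]|
      ≤ 2 * (2 * Real.sqrt N) ^ 2 * ρ' ^ ⌊setDistEdges Λ₁ Λ₂ / (D + 2 : ℕ)⌋₊ *
          (∑ y ∈ Λ₁, (if y ∈ Λ₁ then 1 * (K₁ : ℝ) else 0)) *
          ∑ y ∈ Λ₂, (if y ∈ Λ₂ then 1 * (K₂ : ℝ) else 0) := key
    _ = 2 * (2 * Real.sqrt N) ^ 2 * Real.exp (-(κ * ⌊setDistEdges Λ₁ Λ₂ / (D + 2 : ℕ)⌋₊)) *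
          (∑ y ∈ Λ₁, (if y ∈ Λ₁ then 1 * (K₁ : ℝ) else 0)) *
          ∑ y ∈ Λ₂, (if y ∈ Λ₂ then 1 * (K₂ : ℝ) else 0) := by rw [hpow]
    _ ≤ 2 * (2 * Real.sqrt N) ^ 2 * (Real.exp κ * Real.exp (-(κ / (D + 2 : ℕ)) * setDistEdges Λ₁ Λ₂)) *
          (n * K₁) * (n * K₂) := by gcongr
    _ ≤ 2 * (2 * Real.sqrt N) ^ 2 * (2 * Real.exp (-(κ / (D + 2 : ℕ)) * setDistEdges Λ₁ Λ₂)) *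
          (n * K₁) * (n * K₂) := by gcongr
    _ = 16 * N * (n : ℝ) ^ 2 * Real.exp (-(κ / (D + 2 : ℕ)) * setDistEdges Λ₁ Λ₂) *
          ((K₁ : ℝ) * K₂) := by rw [h16]; ring
    _ ≤ 16 * N * (n : ℝ) ^ 2 * Real.exp (-(κ / (D + 2 : ℕ)) * setDistEdges Λ₁ Λ₂) *
          ((K₁ : ℝ) * K₂ + Real.sqrt (∫ U, F₁ U ^ 2 ∂μ) * Real.sqrt (∫ U, F₂ U ^ 2 ∂μ)) := by
        gcongr
        exact le_add_of_nonneg_right (by positivity)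

/-- `0 < −log(max ρ ½)` for `ρ < 1`. -/
theorem neg_log_max_half_pos {ρ : ℝ} (hρ1 : ρ < 1) : 0 < -Real.log (max ρ (1 / 2)) := by
  rw [neg_pos]
  exact Real.log_neg (lt_of_lt_of_le (by norm_num) (le_max_right _ _)) (max_lt hρ1 (by norm_num))

/-- `1 − ρ' ≤ −log ρ'` for `ρ' = max ρ ½`: the linear reading of the geometric rate. -/
theorem one_sub_le_neg_log_max_half {ρ : ℝ} : 1 - max ρ (1 / 2) ≤ -Real.log (max ρ (1 / 2)) := by
  have h0 : 0 < max ρ (1 / 2) := lt_of_lt_of_le (by norm_num) (le_max_right _ _)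
  have := Real.log_le_sub_one_of_pos h0
  linarith

/-! ### The ball: the uniform mass gap through the robust star door, geometric rate -/

/-- **THE MASS GAP, UNIFORMLY ON THE GAUGE-INVARIANT TIER-1 `ℤ^d` BALL, GEOMETRIC RATE** (hypotheses of ds-2's
`massGapOnBallZdG_of_robustStar`, `ρ ≤ ρ₀ < 1`):
`UniformMassGapOnBallZdG d N β ε₀ ε₁ R (log(1/max(ρ₀,½))/(max R 1 + 4)) (16N)` (compare
`uniformMassGapOnBallZdG_of_robustStar`: rate `starRate d ρ₀/(max R 1 + 4)`, constant `32N`). -/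
theorem uniformMassGapOnBallZdG_of_robustStar_geometric (hd : 2 ≤ d) (hN : 1 ≤ N) {β ε₀ ε₁ Rm K c lam θ ρ ρ₀ : ℝ}
    {R Kn : ℕ} (hK : 0 ≤ K) (hRm : |(N : ℝ) * β| / N * (2 * ((d : ℝ) - 1)) ≤ Rm) (hmod : OneLinkKRModulus N Rm K)
    (hε₁ : 0 ≤ ε₁) (hc : K * Real.exp ε₀ * (1 + 2 * Real.sqrt N * ε₁) * (|(N : ℝ) * β| / N) ≤ c)
    (hlam : Real.sqrt N * ε₁ ≤ lam) (hθ : θ = (2 * (d : ℝ) - 2) * c + lam) (hθ1 : θ < 1)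
    (hcd : doorPoly d c < 1) (hρ : ρ = gaugeR d c + (lam + θ ^ Kn * (4 * d * lam)) / (1 - θ)) (hρle : ρ ≤ ρ₀)
    (hρ1 : ρ₀ < 1) :
    UniformMassGapOnBallZdG d N β ε₀ ε₁ R (-Real.log (max ρ₀ (1 / 2)) / (max R 1 + 4 : ℕ)) (16 * N) := by
  have hc0 : 0 ≤ c := le_trans (by positivity) hc
  have hlam0 : 0 ≤ lam := le_trans (by positivity) hlam
  have hgR : 0 ≤ gaugeR d c ∧ gaugeR d c < 1 := gaugeR_lt_one_of_door hd hc0 hcd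
  have hd2 : (2 : ℝ) ≤ d := by exact_mod_cast hd
  have hθ0 : 0 ≤ θ := by rw [hθ]; nlinarith
  have h1θ : 0 < 1 - θ := by linarith
  have hρ00 : 0 ≤ ρ := by
    rw [hρ]
    refine add_nonneg hgR.1 (div_nonneg (add_nonneg hlam0 ?_) h1θ.le)
    have : 0 ≤ θ ^ Kn := pow_nonneg hθ0 Kn
    positivity
  have hρ₀0 : 0 ≤ ρ₀ := hρ00.trans hρle
  have hDpos : (0 : ℝ) < ((max R 1 + 4 : ℕ) : ℝ) := by positivity
  refine ⟨div_pos (neg_log_max_half_pos hρ1) hDpos, fun W supp hW => ?_⟩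
  have hwin := (starWindowBoundZdR_of_memBallZdG hd hN hK hRm hmod hε₁ hc hlam hθ hθ1 hcd hρ hW).mono_rho hρle
  have hD : R + 2 ≤ max R 1 + 2 := by omega
  refine ⟨(perturbedMassGapAt_of_starWindowBoundZdR hW.continuous hW.dependsOn hW.supportedBy hW.range hD hρ₀0
      hρ1 hwin).1, ?_⟩
  have hcl := perturbedClustering_of_starWindowBoundZdR_geometric hW.continuous hW.dependsOn hW.supportedBy hW.range hD
    hρ1 hwin
  have e4 : (max R 1 + 2 + 2 : ℕ) = max R 1 + 4 := by omega
  rw [e4] at hcl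
  exact hcl

/-- **THE SAME THROUGH THE VARIANCE-FORM ROBUST STAR DOOR** (hypotheses of ds-2's `massGapOnBallZdG_of_robustStar_variance`,
`ρ ≤ ρ₀ < 1`): `UniformMassGapOnBallZdG d N β ε₀ ε₁ R (log(1/max(ρ₀,½))/(max R 1 + 4)) (16N)`. -/
theorem uniformMassGapOnBallZdG_of_robustStar_variance_geometric (hd : 2 ≤ d) (hN : 1 ≤ N)
    {β ε₀ ε₁ b cP v c lam θ ρ ρ₀ : ℝ} {R Kn : ℕ} (hcP : 0 ≤ cP) (hv : 0 ≤ v)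
    (hb : |(N : ℝ) * β| / N * (2 * ((d : ℝ) - 1)) ≤ b) (hP : OneLinkPoincareSUN N b cP)
    (hVB : OneLinkVarianceBound N b v) (hε₁ : 0 ≤ ε₁) (hc : Real.exp ε₀ * Real.sqrt (cP * v) * (|(N : ℝ) * β| / N) ≤ c)
    (hlam : Real.exp (ε₀ / 2) * Real.sqrt cP * ε₁ ≤ lam) (hθ : θ = (2 * (d : ℝ) - 2) * c + lam) (hθ1 : θ < 1)
    (hcd : doorPoly d c < 1) (hρ : ρ = gaugeR d c + (lam + θ ^ Kn * (4 * d * lam)) / (1 - θ)) (hρle : ρ ≤ ρ₀)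
    (hρ1 : ρ₀ < 1) :
    UniformMassGapOnBallZdG d N β ε₀ ε₁ R (-Real.log (max ρ₀ (1 / 2)) / (max R 1 + 4 : ℕ)) (16 * N) := by
  have hc0 : 0 ≤ c := le_trans (by positivity) hc
  have hlam0 : 0 ≤ lam := le_trans (by positivity) hlam
  have hgR : 0 ≤ gaugeR d c ∧ gaugeR d c < 1 := gaugeR_lt_one_of_door hd hc0 hcd
  have hd2 : (2 : ℝ) ≤ d := by exact_mod_cast hd
  have hθ0 : 0 ≤ θ := by rw [hθ]; nlinarith
  have h1θ : 0 < 1 - θ := by linarith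
  have hρ00 : 0 ≤ ρ := by
    rw [hρ]
    refine add_nonneg hgR.1 (div_nonneg (add_nonneg hlam0 ?_) h1θ.le)
    have : 0 ≤ θ ^ Kn := pow_nonneg hθ0 Kn
    positivity
  have hρ₀0 : 0 ≤ ρ₀ := hρ00.trans hρle
  have hDpos : (0 : ℝ) < ((max R 1 + 4 : ℕ) : ℝ) := by positivity
  refine ⟨div_pos (neg_log_max_half_pos hρ1) hDpos, fun W supp hW => ?_⟩
  have hwin := (starWindowBoundZdR_of_memBallZdG_variance hd hN hcP hv hb hP hVB hε₁ hc hlam hθ hθ1 hcd hρ hW).mono_rho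
    hρle
  have hD : R + 2 ≤ max R 1 + 2 := by omega
  refine ⟨(perturbedMassGapAt_of_starWindowBoundZdR hW.continuous hW.dependsOn hW.supportedBy hW.range hD hρ₀0
      hρ1 hwin).1, ?_⟩
  have hcl := perturbedClustering_of_starWindowBoundZdR_geometric hW.continuous hW.dependsOn hW.supportedBy hW.range hD
    hρ1 hwin
  have e4 : (max R 1 + 2 + 2 : ℕ) = max R 1 + 4 := by omega
  rw [e4] at hcl
  exact hcl

/-! ### `SU(2)`, `d = 4`: the schema on the quarter modulus and legible cells -/

/-- **SCHEMA, `SU(2)`, `d = 4`, GEOMETRIC RATE** (the hypotheses of `su2_uniformMassGapOnBallZdG_star`):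
`UniformMassGapOnBallZdG 4 2 (β_W/4) ε₀ ε₁ R (log(1/max(ρ₀,½))/(max R 1 + 4)) 32`. -/
theorem su2_uniformMassGapOnBallZdG_star_geometric (Kn : ℕ) {βW ε₀ ε₁ c lam E S ρ₀ : ℝ} (hβ0 : 0 ≤ βW)
    (hβ : βW ≤ 2 / 3) (hε₁ : 0 ≤ ε₁) (hE : Real.exp ε₀ ≤ E) (hS : Real.sqrt 2 ≤ S)
    (hc : E * (1 + 2 * S * ε₁) * (βW / 4) ≤ c) (hlam : S * ε₁ ≤ lam) (hθ1 : 6 * c + lam < 1) (hcd : doorPoly 4 c < 1)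
    (hρ0 : gaugeR 4 c + (lam + (6 * c + lam) ^ Kn * (16 * lam)) / (1 - (6 * c + lam)) ≤ ρ₀) (hρ1 : ρ₀ < 1)
    (R : ℕ) : UniformMassGapOnBallZdG 4 2 (βW / 4) ε₀ ε₁ R (-Real.log (max ρ₀ (1 / 2)) / (max R 1 + 4 : ℕ)) 32 := by
  -- adapted from `su2_uniformMassGapOnBallZdG_star`
  have hS0 : 0 ≤ S := (Real.sqrt_nonneg _).trans hS
  have hE0 : 0 ≤ E := (Real.exp_pos _).le.trans hE
  set θ : ℝ := 6 * c + lam with hθ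
  set ρ : ℝ := gaugeR 4 c + (lam + θ ^ Kn * (16 * lam)) / (1 - θ) with hρ
  have habs : |((2 : ℕ) : ℝ) * (βW / 4)| / ((2 : ℕ) : ℝ) = βW / 4 := by
    rw [abs_of_nonneg (by positivity)]
    push_cast
    ring
  have hR : |((2 : ℕ) : ℝ) * (βW / 4)| / ((2 : ℕ) : ℝ) * (2 * (((4 : ℕ) : ℝ) - 1)) ≤ 3 * βW / 2 := by
    rw [habs]; push_cast; linarith
  have hc' : (1 : ℝ) * Real.exp ε₀ * (1 + 2 * Real.sqrt ((2 : ℕ) : ℝ) * ε₁) *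
      (|((2 : ℕ) : ℝ) * (βW / 4)| / ((2 : ℕ) : ℝ)) ≤ c := by
    refine le_trans ?_ hc
    have h1 : Real.sqrt ((2 : ℕ) : ℝ) = Real.sqrt 2 := by norm_num
    rw [h1, one_mul, habs]
    have hb : 0 ≤ βW / 4 := by positivity
    calc Real.exp ε₀ * (1 + 2 * Real.sqrt 2 * ε₁) * (βW / 4) ≤ E * (1 + 2 * Real.sqrt 2 * ε₁) * (βW / 4) := by
          gcongr
      _ ≤ E * (1 + 2 * S * ε₁) * (βW / 4) := by gcongr
  have hlam' : Real.sqrt ((2 : ℕ) : ℝ) * ε₁ ≤ lam := by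
    have h1 : Real.sqrt ((2 : ℕ) : ℝ) = Real.sqrt 2 := by norm_num
    rw [h1]; exact le_trans (mul_le_mul_of_nonneg_right hS hε₁) hlam
  have hθ' : θ = (2 * ((4 : ℕ) : ℝ) - 2) * c + lam := by rw [hθ]; push_cast; ring
  have hρ' : ρ = gaugeR 4 c + (lam + θ ^ Kn * (4 * ((4 : ℕ) : ℝ) * lam)) / (1 - θ) := by rw [hρ]; push_cast; ring
  have h32 : (16 * ((2 : ℕ) : ℝ) : ℝ) = 32 := by norm_num
  rw [← h32]
  exact uniformMassGapOnBallZdG_of_robustStar_geometric (d := 4) (N := 2) (by norm_num) (by norm_num) zero_le_one hR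
    (su2_quarterModulus hβ) hε₁ hc' hlam' hθ' hθ1 hcd hρ' hρ0 hρ1

/-- **CELL `β_W = 1/8`, QUARTER RADIUS `(ε₀, ε₁) = (37/500, 37/1000)`**: received sum `≤ 7/20 ≤ 1/2` ⇒ EVERY member of
`MemBallZdG (37/500) (37/1000) R` at 't Hooft `1/32` has one DLR state clustering at rate `log 2/(max R 1 + 4)` with constant
`32 n²` (the tree's `su2_uniformStar_oneEighth_quarterRadius`: rate `(1/32)/(max R 1 + 4)`, constant `64`). -/
theorem su2_uniformStar_oneEighth_quarterRadius_geometric (R : ℕ) :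
    UniformMassGapOnBallZdG 4 2 (1 / 32) (37 / 500) (37 / 1000) R (Real.log 2 / (max R 1 + 4 : ℕ)) 32 := by
  have e1 : (1 / 8 : ℝ) / 4 = 1 / 32 := by norm_num
  have h := su2_uniformMassGapOnBallZdG_star_geometric 20 (βW := 1 / 8) (ε₀ := 37 / 500) (ε₁ := 37 / 1000)
    (c := 9293 / 250000) (lam := 52327 / 1000000) (ρ₀ := 7 / 20) (by norm_num) (by norm_num) (by norm_num)
    (exp_le_taylor4 (x := 37 / 500) (by norm_num) (by norm_num)) sqrt_two_le (by norm_num) (by norm_num)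
    (by norm_num) (by unfold doorPoly; norm_num) (by unfold gaugeR Delta; norm_num) (by norm_num) R
  rw [e1] at h
  have hmax : max (7 / 20 : ℝ) (1 / 2) = 1 / 2 := by norm_num
  have hlog : -Real.log (max (7 / 20 : ℝ) (1 / 2)) = Real.log 2 := by
    rw [hmax, one_div, Real.log_inv, neg_neg]
  rw [hlog] at h
  exact h

/-- **CELL `β_W = 1/8`, HALF RADIUS `(ε₀, ε₁) = (37/250, 37/500)`**: received sum `≤ 13/25` ⇒ rate `log(25/13)/(max R 1 + 4)`
(`≈ 0.654/…`; the tree's cell: `(1/81)/…`), constant `32 n²`. -/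
theorem su2_uniformStar_oneEighth_halfRadius_geometric (R : ℕ) :
    UniformMassGapOnBallZdG 4 2 (1 / 32) (37 / 250) (37 / 500) R (Real.log (25 / 13) / (max R 1 + 4 : ℕ)) 32 := by
  have e1 : (1 / 8 : ℝ) / 4 = 1 / 32 := by norm_num
  have h := su2_uniformMassGapOnBallZdG_star_geometric 20 (βW := 1 / 8) (ε₀ := 37 / 250) (ε₁ := 37 / 500)
    (c := 2191 / 50000) (lam := 104653 / 1000000) (ρ₀ := 13 / 25) (by norm_num) (by norm_num) (by norm_num)
    (exp_le_taylor4 (x := 37 / 250) (by norm_num) (by norm_num)) sqrt_two_le (by norm_num) (by norm_num)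
    (by norm_num) (by unfold doorPoly; norm_num) (by unfold gaugeR Delta; norm_num) (by norm_num) R
  rw [e1] at h
  have hmax : max (13 / 25 : ℝ) (1 / 2) = 13 / 25 := by norm_num
  have hlog : -Real.log (max (13 / 25 : ℝ) (1 / 2)) = Real.log (25 / 13) := by
    rw [hmax, ← Real.log_inv]; norm_num
  rw [hlog] at h
  exact h

/-- **CELL `β_W = 1/4`, HALF RADIUS `(ε₀, ε₁) = (11/200, 11/400)` — BEYOND THE SINGLE-LINK THRESHOLD `2/9`**: received sum
`≤ 3/4` ⇒ rate `log(4/3)/(max R 1 + 4)` (`≈ 0.288/…`; the tree's cell: `(1/416)/…` — a factor `> 100`), constant `32 n²`. -/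
theorem su2_uniformStar_oneQuarter_halfRadius_geometric (R : ℕ) :
    UniformMassGapOnBallZdG 4 2 (1 / 16) (11 / 200) (11 / 400) R (Real.log (4 / 3) / (max R 1 + 4 : ℕ)) 32 := by
  have e1 : (1 / 4 : ℝ) / 4 = 1 / 16 := by norm_num
  have h := su2_uniformMassGapOnBallZdG_star_geometric 20 (βW := 1 / 4) (ε₀ := 11 / 200) (ε₁ := 11 / 400)
    (c := 71171 / 1000000) (lam := 9723 / 250000) (ρ₀ := 3 / 4) (by norm_num) (by norm_num) (by norm_num)
    (exp_le_taylor4 (x := 11 / 200) (by norm_num) (by norm_num)) sqrt_two_le (by norm_num) (by norm_num)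
    (by norm_num) (by unfold doorPoly; norm_num) (by unfold gaugeR Delta; norm_num) (by norm_num) R
  rw [e1] at h
  have hmax : max (3 / 4 : ℝ) (1 / 2) = 3 / 4 := by norm_num
  have hlog : -Real.log (max (3 / 4 : ℝ) (1 / 2)) = Real.log (4 / 3) := by
    rw [hmax, ← Real.log_inv]; norm_num
  rw [hlog] at h
  exact h

end Summit.Ventures.YMGap.RobustBall

end
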